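import Summits.AtomisticToContinuum.BoseEinsteinCondensation.Theorems.BECConjugateDominationPositiveMinimiserFreeHeatDeriv
import Mathlib.Analysis.SpecialFunctions.Integrability.Basic
import Mathlib.MeasureTheory.Integral.DominatedConvergence
import HarnessLib

/-!
# Route `BECConjugateDomination`, support item `PositiveMinimiser` — the free heat operator, III:
# derivatives of `P_t f` and of the Duhamel term

Third infrastructure file for the `C³` regularity of the periodic Feynman–Kac ground state
(item stmt-AtomisticToContinuum-11787). For continuous periodic (hence bounded) data `f` with
values in a real Banach space `E`:

* periodic bookkeeping for `E`-valued functions (bounds, periodicity of `fderiv`, of `P_t f`,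
  of `duhamel T f`);
* `hasFDerivAt_heatOp_of_contDiff` — for `C¹` data with `f`, `Df` bounded,
  `D(P_t f)(X) = P_t (Df)(X)` (differentiation under the Wiener integral);
* `continuousOn_heatGrad_time` — `s ↦ heatGrad s f X` is continuous on `(0, ∞)`;
* `hasFDerivAt_duhamel` — for continuous bounded `f` and `T ≥ 0`,
  `D(duhamel T f)(X) = ∫₀ᵀ heatGrad s f X ds` (the Gaussian gradient bound `≲ s^{-1/2}` is
  integrable at `0`), and this derivative is continuous in `X` (`continuous_duhamelGrad`);
* `hasFDerivAt_duhamel_of_contDiff` — for `C¹` data, `D(duhamel T f) = duhamel T (Df)`.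

All [folklore] (Gaussian semigroup smoothing).
-/

noncomputable section

namespace Summit.AtomisticToContinuum.BoseEinsteinCondensation.Theorems.PositiveMinimiser

open MeasureTheory ProbabilityTheory Filter Set Metric intervalIntegral
open scoped ENNReal NNReal Topology Interval
open Literature.MathematicalPhysics.QuantumManyBody.BoseGas
open Literature.Probability.Process (brownian runSup)

variable {N : ℕ} {E : Type} [NormedAddCommGroup E] [NormedSpace ℝ E]

/-! ### Periodic `E`-valued functions -/

omit [NormedSpace ℝ E] in
/-- **A continuous periodic `E`-valued function is bounded** (it factors through the compact closed
cell). [folklore] -/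
theorem exists_bound_of_continuous_periodicE {L : ℝ} (hL : 0 < L) {f : Config N → E}
    (hf : Continuous f)
    (hper : ∀ (X : Config N) (i : Fin N) (k : Fin 3),
      f (X + Pi.single i (EuclideanSpace.single k L)) = f X) :
    ∃ M : ℝ, 0 ≤ M ∧ ∀ X, ‖f X‖ ≤ M := by
  obtain ⟨hKc, hKsub⟩ := isCompact_closedCellN N L
  obtain ⟨C, hC⟩ := hKc.exists_bound_of_continuousOn hf.continuousOn
  refine ⟨max C 0, le_max_right _ _, fun X => ?_⟩
  rw [← apply_cellProj_of_periodic hper X]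
  exact (hC _ (hKsub (cellProj_mem_cellN hL X))).trans (le_max_left _ _)

/-- **The derivative of a periodic function is periodic.** [folklore] -/
theorem fderiv_periodicE {L : ℝ} {f : Config N → E}
    (hper : ∀ (X : Config N) (i : Fin N) (k : Fin 3),
      f (X + Pi.single i (EuclideanSpace.single k L)) = f X)
    (X : Config N) (i : Fin N) (k : Fin 3) :
    fderiv ℝ f (X + Pi.single i (EuclideanSpace.single k L)) = fderiv ℝ f X := by
  have h : f = fun Y => f (Y + Pi.single i (EuclideanSpace.single k L)) := by
    funext Y; rw [hper]
  conv_rhs => rw [h]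
  rw [fderiv_comp_add_right]

/-! ### Derivative of `P_t f` for `C¹` data -/

/-- **`D(P_t f)(X) = P_t(Df)(X)` for `C¹` data with `f` and `Df` bounded** (differentiation under
the Wiener integral). [folklore] -/
theorem hasFDerivAt_heatOp_of_contDiff [CompleteSpace E] {f : Config N → E} (hf : ContDiff ℝ 1 f)
    {M M' : ℝ} (hM : ∀ Y, ‖f Y‖ ≤ M) (hM' : ∀ Y, ‖fderiv ℝ f Y‖ ≤ M') (t : ℝ≥0) (X : Config N) :
    HasFDerivAt (heatOp t f) (heatOp t (fderiv ℝ f) X) X := by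
  have hfc : Continuous f := hf.continuous
  have hfd : Differentiable ℝ f := hf.differentiable one_ne_zero
  have hfdc : Continuous (fderiv ℝ f) := hf.continuous_fderiv one_ne_zero
  have h := hasFDerivAt_integral_of_dominated_of_fderiv_le (μ := wienerPaths N)
    (F := fun X' ω => f (X' + displacement t ω))
    (F' := fun X' ω => fderiv ℝ f (X' + displacement t ω)) (x₀ := X) (bound := fun _ => M')
    (ball_mem_nhds X one_pos)
    (Eventually.of_forall fun X' => aestronglyMeasurable_comp_add_displacement hfc X' t)
    (integrable_comp_add_displacement hfc hM X t)
    (aestronglyMeasurable_comp_add_displacement hfdc X t)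
    (Eventually.of_forall fun ω X' _ => hM' _) (integrable_const M')
    (Eventually.of_forall fun ω X' _ =>
      ((hfd (X' + displacement t ω)).hasFDerivAt).comp X' ((hasFDerivAt_id X').add_const _))
  exact h

/-- **For `C¹` data with `f`, `Df` bounded, `fderiv (P_t f) = P_t (Df)`.** [folklore] -/
theorem fderiv_heatOp_of_contDiff [CompleteSpace E] {f : Config N → E} (hf : ContDiff ℝ 1 f)
    {M M' : ℝ} (hM : ∀ Y, ‖f Y‖ ≤ M) (hM' : ∀ Y, ‖fderiv ℝ f Y‖ ≤ M') (t : ℝ≥0) :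
    fderiv ℝ (heatOp t f) = heatOp t (fderiv ℝ f) :=
  funext fun X => (hasFDerivAt_heatOp_of_contDiff hf hM hM' t X).fderiv

/-! ### Continuity of the Gaussian gradient in time -/

/-- The path-space integrand of `heatGrad` is continuous in time along every sample. [folklore] -/
theorem continuous_heatGrad_integrand_time {f : Config N → E} (hf : Continuous f) (X : Config N)
    (ω : PathSpace N) :
    Continuous fun t : ℝ≥0 =>
      (cfgInner (N := N) (displacement t ω)).smulRight (f (X + displacement t ω)) :=
  continuous_smulRight_pair.comp ((continuous_cfgInner.comp (continuous_displacement ω)).prodMk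
    (hf.comp (continuous_const.add (continuous_displacement ω))))

/-- **`t ↦ heatGrad t f X` is continuous at every `t₀ > 0`** (dominated convergence with the
running supremum of the Brownian coordinates on `[0, t₀ + 1]`). [folklore] -/
theorem continuousAt_heatGrad_time {f : Config N → E} (hf : Continuous f) {M : ℝ}
    (hM : ∀ Y, ‖f Y‖ ≤ M) (X : Config N) {t₀ : ℝ≥0} (ht₀ : t₀ ≠ 0) :
    ContinuousAt (fun t : ℝ≥0 => heatGrad t f X) t₀ := by
  have hM0 : 0 ≤ M := (norm_nonneg _).trans (hM 0)
  have ht₀' : (0 : ℝ) < t₀ := lt_of_le_of_ne t₀.coe_nonneg (fun h => ht₀ (by exact_mod_cast h.symm))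
  -- the integral part
  have hint : ContinuousAt (fun t : ℝ≥0 => ∫ ω : PathSpace N,
      (cfgInner (N := N) (displacement t ω)).smulRight (f (X + displacement t ω)) ∂wienerPaths N) t₀ := by
    refine continuousAt_of_dominated
      (bound := fun ω => N * M * (Real.sqrt 2 * ∑ i, ∑ k, runSup (t₀ + 1) (ω i k)))
      (Eventually.of_forall fun t => (continuous_smulRight_comp hf X).comp_aestronglyMeasurable
        (measurable_displacement t).aestronglyMeasurable) ?_
      (((integrable_sum_runSup (t₀ + 1)).const_mul (Real.sqrt 2)).const_mul (N * M))
      (Eventually.of_forall fun ω => (continuous_heatGrad_integrand_time hf X ω).continuousAt)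
    filter_upwards [Iic_mem_nhds (lt_add_one t₀)] with t ht
    refine Eventually.of_forall fun ω => ?_
    calc ‖(cfgInner (displacement t ω)).smulRight (f (X + displacement t ω))‖
        ≤ N * ‖displacement t ω‖ * ‖f (X + displacement t ω)‖ := norm_smulRight_cfgInner_le _ _
      _ ≤ N * ‖displacement t ω‖ * M :=
          mul_le_mul_of_nonneg_left (hM _) (mul_nonneg (Nat.cast_nonneg _) (norm_nonneg _))
      _ = N * M * ‖displacement t ω‖ := by ring
      _ ≤ N * M * (Real.sqrt 2 * ∑ i, ∑ k, runSup (t₀ + 1) (ω i k)) :=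
          mul_le_mul_of_nonneg_left (norm_displacement_le_sum_runSup ht ω) (by positivity)
  -- the scalar part
  have hsc : ContinuousAt (fun t : ℝ≥0 => ((2 * (t : ℝ))⁻¹ : ℝ)) t₀ :=
    ((continuous_const.mul NNReal.continuous_coe).continuousAt).inv₀ (mul_pos two_pos ht₀').ne'
  unfold heatGrad
  exact hsc.smul hint

/-- **`s ↦ heatGrad s⁺ f X` is continuous on `(0, ∞)`** (real time). [folklore] -/
theorem continuousOn_heatGrad_time {f : Config N → E} (hf : Continuous f) {M : ℝ}
    (hM : ∀ Y, ‖f Y‖ ≤ M) (X : Config N) :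
    ContinuousOn (fun s : ℝ => heatGrad s.toNNReal f X) (Ioi 0) := by
  intro s hs
  have hs' : s.toNNReal ≠ 0 := by
    rw [ne_eq, Real.toNNReal_eq_zero, not_le]; exact hs
  exact ((continuousAt_heatGrad_time hf hM X hs').comp
    continuous_real_toNNReal.continuousAt).continuousWithinAt

/-- The real-time Gaussian gradient is a.e. strongly measurable on every `Ι 0 T`. [folklore] -/
theorem aestronglyMeasurable_heatGrad_time {f : Config N → E} (hf : Continuous f) {M : ℝ}
    (hM : ∀ Y, ‖f Y‖ ≤ M) (X : Config N) (T : ℝ) :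
    AEStronglyMeasurable (fun s : ℝ => heatGrad s.toNNReal f X) (volume.restrict (Ι 0 T)) := by
  rcases le_or_gt 0 T with hT | hT
  · rw [uIoc_of_le hT]
    exact ((continuousOn_heatGrad_time hf hM X).mono Ioc_subset_Ioi_self).aestronglyMeasurable
      measurableSet_Ioc
  · rw [uIoc_of_ge hT.le]
    refine (aestronglyMeasurable_const (b := heatGrad 0 f X)).congr ?_
    refine (ae_restrict_iff' measurableSet_Ioc).2 (Eventually.of_forall fun s hs => ?_)
    simp only [Real.toNNReal_of_nonpos hs.2]

/-! ### Derivative of the Duhamel term -/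

/-- The constant in the Gaussian gradient bound, `‖heatGrad s f X‖ ≤ gradConst N M · s^{-1/2}`:
`gradConst N M = N M √2 · 3N`. [folklore] -/
theorem norm_heatGrad_le_rpow {f : Config N → E} {M : ℝ} (hM : ∀ Y, ‖f Y‖ ≤ M) {s : ℝ}
    (hs : 0 < s) (X : Config N) :
    ‖heatGrad s.toNNReal f X‖ ≤ (N * M * (Real.sqrt 2 * (3 * N : ℕ))) * s ^ (-(1 / 2 : ℝ)) := by
  have hM0 : 0 ≤ M := (norm_nonneg _).trans (hM 0)
  have h := norm_heatGrad_le hM s.toNNReal X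
  rw [Real.coe_toNNReal _ hs.le] at h
  refine h.trans (le_of_eq ?_)
  have hsq : Real.sqrt s ≠ 0 := (Real.sqrt_pos.2 hs).ne'
  have h2 : (2 * s)⁻¹ = (2 * (Real.sqrt s * Real.sqrt s))⁻¹ := by rw [Real.mul_self_sqrt hs.le]
  rw [Real.rpow_neg hs.le, ← Real.sqrt_eq_rpow, h2]
  field_simp

/-- The bound `s ↦ C s^{-1/2}` is interval integrable. [folklore] -/
theorem intervalIntegrable_const_mul_rpow (C a b : ℝ) :
    IntervalIntegrable (fun s : ℝ => C * s ^ (-(1 / 2 : ℝ))) volume a b :=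
  (intervalIntegral.intervalIntegrable_rpow' (by norm_num)).const_mul C

/-- **Derivative of the Duhamel term for continuous bounded data**: for `T ≥ 0`,
`D(duhamel T f)(X) = ∫₀ᵀ heatGrad s f X ds`. [folklore] -/
theorem hasFDerivAt_duhamel [CompleteSpace E] {f : Config N → E} (hf : Continuous f) {M : ℝ}
    (hM : ∀ Y, ‖f Y‖ ≤ M) {T : ℝ} (hT : 0 ≤ T) (X : Config N) :
    HasFDerivAt (duhamel T f) (∫ s in (0 : ℝ)..T, heatGrad s.toNNReal f X) X := by
  have hM0 : 0 ≤ M := (norm_nonneg _).trans (hM 0)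
  set C : ℝ := N * M * (Real.sqrt 2 * (3 * N : ℕ)) with hC
  have h := hasFDerivAt_integral_of_dominated_of_fderiv_le'' (μ := volume)
    (F := fun X' s => heatOpR s f X') (F' := fun X' s => heatGrad s.toNNReal f X') (x₀ := X)
    (a := 0) (b := T) (bound := fun s => C * s ^ (-(1 / 2 : ℝ))) (ball_mem_nhds X one_pos)
    (Eventually.of_forall fun X' => (continuous_heatOpR hf hM X').aestronglyMeasurable)
    ((continuous_heatOpR hf hM X).intervalIntegrable 0 T)
    (aestronglyMeasurable_heatGrad_time hf hM X T) ?_ (intervalIntegrable_const_mul_rpow C 0 T) ?_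
  · exact h
  · rw [uIoc_of_le hT, ae_restrict_iff' measurableSet_Ioc]
    refine Eventually.of_forall fun s hs X' _ => ?_
    exact norm_heatGrad_le_rpow hM hs.1 X'
  · rw [uIoc_of_le hT, ae_restrict_iff' measurableSet_Ioc]
    refine Eventually.of_forall fun s hs X' _ => ?_
    have hs' : s.toNNReal ≠ 0 := by
      rw [ne_eq, Real.toNNReal_eq_zero, not_le]; exact hs.1
    have := hasFDerivAt_heatOp hs' hf hM X'
    exact this

/-- **The derivative of the Duhamel term is continuous in the base point** (continuous bounded
data, `T ≥ 0`). [folklore] -/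
theorem continuous_duhamelGrad [CompleteSpace E] {f : Config N → E} (hf : Continuous f) {M : ℝ}
    (hM : ∀ Y, ‖f Y‖ ≤ M) {T : ℝ} (hT : 0 ≤ T) :
    Continuous fun X : Config N => ∫ s in (0 : ℝ)..T, heatGrad s.toNNReal f X := by
  have hM0 : 0 ≤ M := (norm_nonneg _).trans (hM 0)
  set C : ℝ := N * M * (Real.sqrt 2 * (3 * N : ℕ)) with hC
  refine intervalIntegral.continuous_of_dominated_interval
    (bound := fun s => C * s ^ (-(1 / 2 : ℝ)))
    (fun X => aestronglyMeasurable_heatGrad_time hf hM X T) (fun X => ?_)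
    (intervalIntegrable_const_mul_rpow C 0 T) ?_
  · refine Eventually.of_forall fun s hs => ?_
    rw [uIoc_of_le hT] at hs
    exact norm_heatGrad_le_rpow hM hs.1 X
  · refine Eventually.of_forall fun s hs => ?_
    exact continuous_heatGrad hf hM _

/-- **`duhamel T f` is `C¹` for continuous bounded data** (`T ≥ 0`), with
`fderiv (duhamel T f) X = ∫₀ᵀ heatGrad s f X ds`. [folklore] -/
theorem contDiff_one_duhamel [CompleteSpace E] {f : Config N → E} (hf : Continuous f) {M : ℝ}
    (hM : ∀ Y, ‖f Y‖ ≤ M) {T : ℝ} (hT : 0 ≤ T) : ContDiff ℝ 1 (duhamel T f) := by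
  have hd : ∀ X, HasFDerivAt (duhamel T f) (∫ s in (0 : ℝ)..T, heatGrad s.toNNReal f X) X :=
    fun X => hasFDerivAt_duhamel hf hM hT X
  have hfd : fderiv ℝ (duhamel T f) = fun X => ∫ s in (0 : ℝ)..T, heatGrad s.toNNReal f X :=
    funext fun X => (hd X).fderiv
  rw [contDiff_one_iff_fderiv, hfd]
  exact ⟨fun X => (hd X).differentiableAt, continuous_duhamelGrad hf hM hT⟩

/-- **`P_t f` is `C¹` for continuous bounded data** (`t > 0`), with `fderiv (P_t f) = heatGrad t f`.
[folklore] -/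
theorem contDiff_one_heatOp {f : Config N → E} (hf : Continuous f) {M : ℝ}
    (hM : ∀ Y, ‖f Y‖ ≤ M) {t : ℝ≥0} (ht : t ≠ 0) : ContDiff ℝ 1 (heatOp t f) := by
  have hd : ∀ X, HasFDerivAt (heatOp t f) (heatGrad t f X) X := fun X => hasFDerivAt_heatOp ht hf hM X
  have hfd : fderiv ℝ (heatOp t f) = fun X => heatGrad t f X := funext fun X => (hd X).fderiv
  rw [contDiff_one_iff_fderiv, hfd]
  exact ⟨fun X => (hd X).differentiableAt, continuous_heatGrad hf hM t⟩

/-- **Derivative of the Duhamel term for `C¹` data with `f`, `Df` bounded**: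
`D(duhamel T f)(X) = duhamel T (Df)(X)`. [folklore] -/
theorem hasFDerivAt_duhamel_of_contDiff [CompleteSpace E] {f : Config N → E} (hf : ContDiff ℝ 1 f)
    {M M' : ℝ} (hM : ∀ Y, ‖f Y‖ ≤ M) (hM' : ∀ Y, ‖fderiv ℝ f Y‖ ≤ M') (T : ℝ) (X : Config N) :
    HasFDerivAt (duhamel T f) (duhamel T (fderiv ℝ f) X) X := by
  have hfc : Continuous f := hf.continuous
  have hfdc : Continuous (fderiv ℝ f) := hf.continuous_fderiv one_ne_zero
  have hM'0 : 0 ≤ M' := (norm_nonneg _).trans (hM' 0)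
  have h := hasFDerivAt_integral_of_dominated_of_fderiv_le'' (μ := volume)
    (F := fun X' s => heatOpR s f X') (F' := fun X' s => heatOpR s (fderiv ℝ f) X') (x₀ := X)
    (a := 0) (b := T) (bound := fun _ => M') (ball_mem_nhds X one_pos)
    (Eventually.of_forall fun X' => (continuous_heatOpR hfc hM X').aestronglyMeasurable)
    ((continuous_heatOpR hfc hM X).intervalIntegrable 0 T)
    ((continuous_heatOpR hfdc hM' X).aestronglyMeasurable)
    (Eventually.of_forall fun s X' _ => norm_heatOp_le hM' _ _) intervalIntegrable_const
    (Eventually.of_forall fun s X' _ => hasFDerivAt_heatOp_of_contDiff hf hM hM' s.toNNReal X')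
  exact h

/-- **For `C¹` data with `f`, `Df` bounded, `fderiv (duhamel T f) = duhamel T (Df)`.** [folklore] -/
theorem fderiv_duhamel_of_contDiff [CompleteSpace E] {f : Config N → E} (hf : ContDiff ℝ 1 f)
    {M M' : ℝ} (hM : ∀ Y, ‖f Y‖ ≤ M) (hM' : ∀ Y, ‖fderiv ℝ f Y‖ ≤ M') (T : ℝ) :
    fderiv ℝ (duhamel T f) = duhamel T (fderiv ℝ f) :=
  funext fun X => (hasFDerivAt_duhamel_of_contDiff hf hM hM' T X).fderiv

end Summit.AtomisticToContinuum.BoseEinsteinCondensation.Theorems.PositiveMinimiser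

end
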